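import Literature.Probability.RandomPlanarGeometry.SLEImageDriverFunctional
import Literature.Probability.RandomPlanarGeometry.SLEImageDriverOneStepVariance
import Literature.Probability.RandomPlanarGeometry.SLERestrictionIncrementKappa
import Literature.Probability.RandomPlanarGeometry.HydrodynamicMaps
import HarnessLib

/-!
# Envelopes for the image driving functional `W̃_t − L_A = W_t − L_{B_t}` of [LSW] §5

Deterministic and pathwise input for the conditional one-step estimates of the image driving value
`W̃_t = W_t + L_A − L_{B_t}` of G. F. Lawler, O. Schramm, W. Werner, *Conformal restriction: the chordal
case*, J. Amer. Math. Soc. **16** (2003) (**[LSW]**), §5 (`B_t = g_t(A) − W_t = slidHull W A t`,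
`L_B = starShift B = −g_B(0)`; path functionals `LFnK`, `imageDrvFnK` of `SLEImageDriverFunctional`),
whose increments are NOT bounded (the sequel `SLEImageDriverIncrement` integrates them):

* **`|L_B| ≤ 580 r` for a `*`-hull with `B ∩ ℍ ⊆ B̄(x, r)`** (`norm_starShift_le`): Lawler's (3.12)
  `|g_B(z) − z| ≤ 3 rad(B)` in the tree's form `IsHydrodynamicMap.norm_sub_self_le` for the bundled map
  `g_B = Φ_B − L_B`, and `g_B(z) − z → −L_B` at `0`;
* **the slid hull of an alive `*`-hull lies in `B̄(0, 3M + 13√t + R)`** when `|W| ≤ M` on `[0, t]`,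
  `A ⊆ B̄(0, R)` (`norm_le_of_mem_slidHull_of_abs_le`, from the uniform displacement bound
  `norm_map_sub_self_le_of_mem_domain`), whence the **envelopes**
  `|LFnK| ≤ 580 (3M + 13√t + R)`, `|imageDrvFnK| ≤ M + 580 (3M + 13√t + R)` (`abs_LFnK_le`,
  `abs_imageDrvFnK_le_of_abs_le`) and, along the Brownian path and the frozen path
  `concat_u(stop_u β(ω), β(ω₂))`, `|ΔimageDrvFnK| ≤ 3482√6 · sup|β| + 15080 √(u+h) + 1160 R`
  (`abs_imageDrvFnK_brownianCPath_sub_le`, `abs_imageDrvFnK_concat_sub_le`);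
* **the frozen step on the good event** (`imageDrvFnK_concat_sub_eq_of_mem_goodEventK`): for
  `√κ sup_{[0,h]}|β(ω₂)| ≤ c₀` the frozen path is alive at `u + h` and its increment over `[u, u + h]` is
  `Loewner.imageDriverStep (A_u − W_u) (√κ β(ω₂)) h` (locality of hulls, `disjoint_closedHull_add`,
  `imageDrvFnK_add_sub`);
* monotonicity of the one-step constants `imageStepC`, `imageStepC₂` in `|d| ≤ 1`, `|c₂| ≤ j` and their
  affine/quadratic dependence on the envelope level `M₀` (`imageStepC_le_of_abs_le`,
  `imageStepC₂_le_of_abs_le`).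

No named fact, no definition.

## References

* [LSW] 2003, §5. [LawlerSchrammWerner2003Restriction]
* G. F. Lawler (2005), §3.4 (3.12), Ch. 4 §4.1 (Lemma 4.13). [Lawler2005]
-/

noncomputable section

open Set Filter Metric Function MeasureTheory
open _root_.Complex _root_.Topology
open UpperHalfPlane (upperHalfPlaneSet)
open Literature.Probability.Process
open scoped NNReal

namespace Literature.Probability.RandomPlanarGeometry

open Loewner PathOps

/-! ### A radius bound for the hydrodynamic constant `L_B` -/

section ShiftBound

variable {B : Set ℂ}

/-- **`|L_B| ≤ 580 r` when `B ∩ ℍ ⊆ B̄(x, r)`**: the bundled map `g_B = Φ_B − L_B : ℍ ∖ B → ℍ` is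
hydrodynamically normalised (`E_B(z) − z → L_B`), so `|g_B(z) − z| ≤ 580 r` on `ℍ ∖ B` (Lawler's
(3.12), `IsHydrodynamicMap.norm_sub_self_le`), and `g_B(z) − z → −L_B` as `z → 0` (`E_B(0) = 0`).
[cite: Lawler2005, §3.4 (3.12)] -/
theorem norm_starShift_le (hB : IsStarHull B) {x r : ℝ} (hr : 0 < r)
    (hBr : B ∩ upperHalfPlaneSet ⊆ closedBall (x : ℂ) r) : ‖starShift B‖ ≤ 580 * r := by
  have hΦ := isRestrictionMap_starRMap hB
  set φ : ConformalEquiv (upperHalfPlaneSet \ B) upperHalfPlaneSet :=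
    (starRMap B hB).trans (addRealUpperHalfPlane (-(starShift B).re)) with hφ
  have hφapp : ∀ z, φ z = starRMap B hB z - starShift B := fun z ↦ by
    conv_rhs => rw [starShift_eq_ofReal_re hB]
    rw [hφ, ConformalEquiv.trans_apply, addRealUpperHalfPlane_apply, ofReal_neg, ← sub_eq_add_neg]
  -- `g_B` is hydrodynamically normalised
  have hH : IsHydrodynamicMap B φ := by
    have h1 := (tendsto_hullExt_sub_self hB.isBoundedHull hΦ).sub_const (hullShift (starRMap B hB))
    rw [sub_self] at h1
    refine (h1.mono_left inf_le_left).congr' ?_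
    filter_upwards [mem_inf_of_right (mem_principal_self _)] with z hz
    rw [hφapp, starShift_eq hB, hullExt_of_mem_diff hz]; ring
  -- `g_B(z) - z → -L_B` at `0`
  have hcont : ContinuousAt (hullExt (starRMap B hB)) 0 :=
    (differentiableAt_hullExt hB.isBoundedHull hΦ hB.zero_mem_symmDomain).continuousAt
  have hlim : Tendsto (fun z ↦ φ z - z) (𝓝[upperHalfPlaneSet \ B] 0) (𝓝 (-starShift B)) := by
    have h1 : Tendsto (fun z ↦ hullExt (starRMap B hB) z - z - starShift B) (𝓝 (0 : ℂ))
        (𝓝 (hullExt (starRMap B hB) 0 - 0 - starShift B)) :=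
      ((hcont.tendsto.sub (continuous_id.tendsto 0)).sub_const _)
    rw [hullExt_zero hB hΦ, sub_zero, zero_sub] at h1
    refine (h1.mono_left nhdsWithin_le_nhds).congr' ?_
    filter_upwards [self_mem_nhdsWithin] with z hz
    rw [hφapp, hullExt_of_mem_diff hz]; ring
  have hbound : ∀ᶠ z in 𝓝[upperHalfPlaneSet \ B] 0, ‖φ z - z‖ ≤ 580 * r := by
    filter_upwards [self_mem_nhdsWithin] with z hz
    exact hH.norm_sub_self_le hBr hr hz
  haveI : (𝓝[upperHalfPlaneSet \ B] (0 : ℂ)).NeBot := mem_closure_iff_nhdsWithin_neBot.1 hB.zero_mem_closure_diff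
  have := le_of_tendsto hlim.norm hbound
  rwa [norm_neg] at this

/-- `|L_B| ≤ 580 r` for a `*`-hull inside `B̄(0, r)`. [cite: Lawler2005, §3.4 (3.12)] -/
theorem abs_starShift_re_le (hB : IsStarHull B) {r : ℝ} (hr : 0 < r) (hBr : B ⊆ closedBall (0 : ℂ) r) :
    |(starShift B).re| ≤ 580 * r := by
  refine (abs_re_le_norm _).trans (norm_starShift_le hB hr (x := 0) fun z hz ↦ ?_)
  rw [ofReal_zero]; exact hBr hz.1

end ShiftBound

/-! ### The size of the slid hull and the envelopes of the image driving functional -/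

section Envelope

variable {W : ℝ≥0 → ℝ} {A : Set ℂ}

/-- **The slid hull `g_t(A) − W_t` of an alive `*`-hull lies in `B̄(0, 3M + 13√t + R)`** when
`|W| ≤ M` on `[0, t]` and `A ⊆ B̄(0, R)` (uniform displacement bound `|g_t z − z| ≤ 2M + 13√t`,
`norm_map_sub_self_le_of_mem_domain`, extended to the real points of `A = cl(A ∩ ℍ)` by continuity).
[cite: Lawler2005, Ch. 4 §4.1 (Lemma 4.13)] -/
theorem norm_le_of_mem_slidHull_of_abs_le (hW : Continuous W) (hA : IsStarHull A) {t : ℝ≥0}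
    (halive : Disjoint (closedHull W t) A) {M R : ℝ} (hM : ∀ s : ℝ≥0, s ≤ t → |W s| ≤ M)
    (hR : A ⊆ closedBall (0 : ℂ) R) {b : ℂ} (hb : b ∈ slidHull W A t) :
    ‖b‖ ≤ 3 * M + 13 * Real.sqrt t + R := by
  obtain ⟨a, ha, rfl⟩ := hb
  have hM' : ∀ u ∈ Icc (0 : ℝ) t, ‖((W u.toNNReal : ℝ) : ℂ) - 0‖ ≤ M := fun u hu ↦ by
    rw [sub_zero, norm_real, Real.norm_eq_abs]
    exact hM _ (Real.toNNReal_le_iff_le_coe.2 hu.2)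
  -- the displacement bound on `A ∩ ℍ`, then on `A` by continuity
  have hdisp : ∀ z ∈ A ∩ upperHalfPlaneSet, ‖map W t z - z‖ ≤ 2 * M + 13 * Real.sqrt t := fun z hz ↦
    norm_map_sub_self_le_of_mem_domain hW hM' ((mem_domain_iff W t z).2 ⟨hz.2, lt_swallowingTime_of_alive hA halive hz.1⟩)
  have hdispa : ‖map W t a - a‖ ≤ 2 * M + 13 * Real.sqrt t := by
    have hcont : ContinuousAt (fun z ↦ ‖map W t z - z‖) a :=
      ((continuousAt_map hW (lt_swallowingTime_of_alive hA halive ha)).sub continuousAt_id).norm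
    have hcl : a ∈ closure (A ∩ upperHalfPlaneSet) := by rw [hA.isBoundedHull.2.1]; exact ha
    obtain ⟨w, hw, hwa⟩ := mem_closure_iff_seq_limit.1 hcl
    exact le_of_tendsto' (hcont.tendsto.comp hwa) fun k ↦ hdisp _ (hw k)
  have haR : ‖a‖ ≤ R := mem_closedBall_zero_iff.1 (hR ha)
  have hWt : ‖(W t : ℂ)‖ ≤ M := by rw [norm_real, Real.norm_eq_abs]; exact hM t le_rfl
  calc ‖map W t a - W t‖ = ‖(map W t a - a) + a - W t‖ := by ring_nf
    _ ≤ ‖map W t a - a‖ + ‖a‖ + ‖(W t : ℂ)‖ := norm_sub_le_of_le (norm_add_le _ _) le_rfl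
    _ ≤ _ := by linarith

variable {κ : ℝ≥0} {t : ℝ≥0} {υ : C(ℝ≥0, ℝ)} {M R : ℝ}

/-- **Envelope of `L_{B_t} 𝟙{alive}`**: `|LFnK κ A t υ| ≤ 580 (3M + 13√t + R)` when `|W| ≤ M` on
`[0, t]` (`W = drvK κ υ`) and `A ⊆ B̄(0, R)`, `R > 0`. [cite: Lawler2005, §3.4 (3.12)] -/
theorem abs_LFnK_le (hA : IsStarHull A) (hR0 : 0 < R) (hR : A ⊆ closedBall (0 : ℂ) R) (hM0 : 0 ≤ M)
    (hM : ∀ s : ℝ≥0, s ≤ t → |drvK κ υ s| ≤ M) : |LFnK κ A t υ| ≤ 580 * (3 * M + 13 * Real.sqrt t + R) := by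
  have hr : 0 < 3 * M + 13 * Real.sqrt t + R := by positivity
  by_cases halive : Disjoint (closedHull (drvK κ υ) t) A
  · rw [LFnK_of_alive halive]
    exact abs_starShift_re_le (Loewner.isStarHull_slidHull_of_disjoint (continuous_drvK κ υ) hA halive) hr fun b hb ↦
      mem_closedBall_zero_iff.2 (norm_le_of_mem_slidHull_of_abs_le (continuous_drvK κ υ) hA halive hM hR hb)
  · rw [LFnK_of_not_alive halive, abs_zero]; positivity

/-- **Envelope of the image driving functional**: `|imageDrvFnK κ A t υ| ≤ M + 580 (3M + 13√t + R)`.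
[folklore] -/
theorem abs_imageDrvFnK_le_of_abs_le (hA : IsStarHull A) (hR0 : 0 < R) (hR : A ⊆ closedBall (0 : ℂ) R) (hM0 : 0 ≤ M)
    (hM : ∀ s : ℝ≥0, s ≤ t → |drvK κ υ s| ≤ M) :
    |imageDrvFnK κ A t υ| ≤ M + 580 * (3 * M + 13 * Real.sqrt t + R) :=
  (abs_imageDrvFnK_le κ A t υ).trans (add_le_add (hM t le_rfl) (abs_LFnK_le hA hR0 hR hM0 hM))

/-- The driver of the Brownian path is dominated by the running supremum: `|W_s| ≤ √κ runSup t` for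
`s ≤ t`. [folklore] -/
theorem abs_drvK_brownianCPath_le (κ : ℝ≥0) {t s : ℝ≥0} (hs : s ≤ t) (ω : ℝ≥0 → ℝ) :
    |drvK κ (brownianCPath ω) s| ≤ Real.sqrt κ * runSup t ω := by
  have : drvK κ (brownianCPath ω) s = Real.sqrt κ * brownian s ω := by
    simp only [drvK, brownianCPath_apply, Literature.Probability.Process.brownian_zero, Pi.zero_apply, sub_zero]
  rw [this, abs_mul, abs_of_nonneg (Real.sqrt_nonneg _)]
  exact mul_le_mul_of_nonneg_left (abs_brownian_le_runSup hs ω) (Real.sqrt_nonneg _)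

/-- The driver of the frozen path `concat_u(stop_u β(ω), β(ω₂))` on `[0, u + h]` is dominated by
`√κ (runSup u ω + runSup h ω₂)`. [folklore] -/
theorem abs_drvK_concat_le (κ : ℝ≥0) {u h s : ℝ≥0} (hs : s ≤ u + h) (ω ω₂ : ℝ≥0 → ℝ) :
    |drvK κ (concat u (stop u (brownianCPath ω), brownianCPath ω₂)) s| ≤ Real.sqrt κ * (runSup u ω + runSup h ω₂) := by
  have h0u := runSup_nonneg u ω
  have h0h := runSup_nonneg h ω₂
  have hs0 := Real.sqrt_nonneg (κ : ℝ)
  rcases le_or_gt s u with hsu | hus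
  · rw [drvK_concat_of_le _ _ hsu, drvK_stop_of_le κ _ hsu]
    calc _ ≤ Real.sqrt κ * runSup u ω := abs_drvK_brownianCPath_le κ hsu ω
      _ ≤ _ := by nlinarith
  · obtain ⟨r, rfl⟩ : ∃ r, s = u + r := ⟨s - u, (add_tsub_cancel_of_le hus.le).symm⟩
    have hr : r ≤ h := le_of_add_le_add_left hs
    have h1 := drvK_concat_add_sub (κ := κ) (u := u) (stop u (brownianCPath ω)) (brownianCPath ω₂) (brownianCPath_zero ω₂) r
    have h2 : drvK κ (concat u (stop u (brownianCPath ω), brownianCPath ω₂)) u = drvK κ (brownianCPath ω) u := by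
      rw [drvK_concat_of_le _ _ le_rfl, drvK_stop_of_le κ _ le_rfl]
    have h3 : drvK κ (concat u (stop u (brownianCPath ω), brownianCPath ω₂)) (u + r) =
        drvK κ (brownianCPath ω) u + Real.sqrt κ * brownian r ω₂ := by
      rw [h2, brownianCPath_apply] at h1; linarith
    rw [h3]
    have e1 := abs_drvK_brownianCPath_le κ (le_refl u) ω
    have e2 : |Real.sqrt κ * brownian r ω₂| ≤ Real.sqrt κ * runSup h ω₂ := by
      rw [abs_mul, abs_of_nonneg hs0]; exact mul_le_mul_of_nonneg_left (abs_brownian_le_runSup hr ω₂) hs0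
    calc _ ≤ |drvK κ (brownianCPath ω) u| + |Real.sqrt κ * brownian r ω₂| := abs_add_le _ _
      _ ≤ _ := by nlinarith

/-- **Envelope of the increment along the Brownian path** (at `κ = 6`):
`|ΔimageDrvFnK(β(ω))| ≤ 3482√6 · runSup (u + h) ω + 15080 √(u + h) + 1160 R`. [folklore] -/
theorem abs_imageDrvFnK_brownianCPath_sub_le (hA : IsStarHull A) (hR0 : 0 < R) (hAR : A ⊆ closedBall (0 : ℂ) R)
    (u h : ℝ≥0) (ω : ℝ≥0 → ℝ) :
    |imageDrvFnK 6 A (u + h) (brownianCPath ω) - imageDrvFnK 6 A u (brownianCPath ω)| ≤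
      3482 * Real.sqrt 6 * runSup (u + h) ω + (15080 * Real.sqrt ((u + h : ℝ≥0) : ℝ) + 1160 * R) := by
  set M : ℝ := Real.sqrt 6 * runSup (u + h) ω with hM
  have hM0 : 0 ≤ M := by have := runSup_nonneg (u + h) ω; positivity
  have hb1 : ∀ s : ℝ≥0, s ≤ u + h → |drvK 6 (brownianCPath ω) s| ≤ M := fun s hs ↦ by
    have := abs_drvK_brownianCPath_le 6 hs ω; push_cast at this; exact this
  have e1 := abs_imageDrvFnK_le_of_abs_le (κ := 6) (t := u + h) (υ := brownianCPath ω) hA hR0 hAR hM0 hb1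
  have e2 := abs_imageDrvFnK_le_of_abs_le (κ := 6) (t := u) (υ := brownianCPath ω) hA hR0 hAR hM0
    fun s hs ↦ hb1 s (hs.trans le_self_add)
  have hsq : Real.sqrt (u : ℝ) ≤ Real.sqrt ((u + h : ℝ≥0) : ℝ) := Real.sqrt_le_sqrt (by exact_mod_cast le_self_add)
  calc _ ≤ |imageDrvFnK 6 A (u + h) (brownianCPath ω)| + |imageDrvFnK 6 A u (brownianCPath ω)| := abs_sub _ _
    _ ≤ (M + 580 * (3 * M + 13 * Real.sqrt ((u + h : ℝ≥0) : ℝ) + R)) + (M + 580 * (3 * M + 13 * Real.sqrt (u : ℝ) + R)) :=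
        add_le_add e1 e2
    _ ≤ _ := by rw [hM]; nlinarith [hsq]

/-- **Envelope of the frozen increment** (at `κ = 6`):
`|ΔimageDrvFnK(concat_u(stop_u β(ω), β(ω₂)))| ≤ (3482√6 runSup u ω + 15080 √(u+h) + 1160 R) + 3482√6 runSup h ω₂`.
[folklore] -/
theorem abs_imageDrvFnK_concat_sub_le (hA : IsStarHull A) (hR0 : 0 < R) (hAR : A ⊆ closedBall (0 : ℂ) R)
    (u h : ℝ≥0) (ω ω₂ : ℝ≥0 → ℝ) :
    |imageDrvFnK 6 A (u + h) (concat u (stop u (brownianCPath ω), brownianCPath ω₂)) -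
        imageDrvFnK 6 A u (concat u (stop u (brownianCPath ω), brownianCPath ω₂))| ≤
      (3482 * Real.sqrt 6 * runSup u ω + (15080 * Real.sqrt ((u + h : ℝ≥0) : ℝ) + 1160 * R)) +
        3482 * Real.sqrt 6 * runSup h ω₂ := by
  set υ := concat u (stop u (brownianCPath ω), brownianCPath ω₂) with hυ
  set M : ℝ := Real.sqrt 6 * (runSup u ω + runSup h ω₂) with hM
  have hM0 : 0 ≤ M := by have := runSup_nonneg u ω; have := runSup_nonneg h ω₂; positivity
  have hb1 : ∀ s : ℝ≥0, s ≤ u + h → |drvK 6 υ s| ≤ M := fun s hs ↦ by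
    have := abs_drvK_concat_le 6 hs ω ω₂; push_cast at this; exact this
  have e1 := abs_imageDrvFnK_le_of_abs_le (κ := 6) (t := u + h) (υ := υ) hA hR0 hAR hM0 hb1
  have e2 := abs_imageDrvFnK_le_of_abs_le (κ := 6) (t := u) (υ := υ) hA hR0 hAR hM0 fun s hs ↦ hb1 s (hs.trans le_self_add)
  have hsq : Real.sqrt (u : ℝ) ≤ Real.sqrt ((u + h : ℝ≥0) : ℝ) := Real.sqrt_le_sqrt (by exact_mod_cast le_self_add)
  calc _ ≤ |imageDrvFnK 6 A (u + h) υ| + |imageDrvFnK 6 A u υ| := abs_sub _ _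
    _ ≤ (M + 580 * (3 * M + 13 * Real.sqrt ((u + h : ℝ≥0) : ℝ) + R)) + (M + 580 * (3 * M + 13 * Real.sqrt (u : ℝ) + R)) :=
        add_le_add e1 e2
    _ ≤ _ := by rw [hM]; nlinarith [hsq]

end Envelope

/-! ### The frozen step on the good event -/

section Frozen

variable {κ : ℝ≥0} {A : Set ℂ} {u h : ℝ≥0} {ω : ℝ≥0 → ℝ} {δ₀ ρ₀ : ℝ}
variable (hA : IsStarHull A) (halive : Disjoint (closedHull (drvK κ (brownianCPath ω)) u) A) (hρ₀ : 0 < ρ₀) (hρ1 : ρ₀ ≤ 1)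
  (hBρ : Disjoint (ball (0 : ℂ) (8 * ρ₀)) (slidHull (drvK κ (brownianCPath ω)) A u))
  (hδ0 : 0 < δ₀) (hδ : δ₀ ≤ starDeriv (slidHull (drvK κ (brownianCPath ω)) A u)) (hh0 : 0 < h)
  (hh : 32 * (h : ℝ) ≤ (δ₀ * ρ₀ / 4000) ^ 2)

include hA halive hρ₀ hρ1 hBρ hδ0 hδ hh0 hh in
/-- **On the good event `{√κ sup_{[0,h]}|β(ω₂)| ≤ c₀}` the frozen path `concat_u(stop_u β(ω), β(ω₂))`
is still alive at `u + h` and the increment of its image driving functional over `[u, u + h]` is the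
one-step increment `imageDriverStep (A_u − W_u)(ω) (√κ β(ω₂)) h`** (locality of hulls at time `u`,
survival `disjoint_closedHull_add`, `imageDrvFnK_add_sub`). [cite: LawlerSchrammWerner2003Restriction, §5 (the step from t to t + dt)] -/
theorem imageDrvFnK_concat_sub_eq_of_mem_goodEventK {ω₂ : ℝ≥0 → ℝ} (hω₂ : ω₂ ∈ goodEventK κ (δ₀ * ρ₀ / 4000) h) :
    Disjoint (closedHull (drvK κ (concat u (stop u (brownianCPath ω), brownianCPath ω₂))) (u + h)) A ∧
      imageDrvFnK κ A (u + h) (concat u (stop u (brownianCPath ω), brownianCPath ω₂)) -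
          imageDrvFnK κ A u (concat u (stop u (brownianCPath ω), brownianCPath ω₂)) =
        imageDriverStep (slidHull (drvK κ (brownianCPath ω)) A u) (stepDriverK κ ω₂) h := by
  set p := brownianCPath ω with hp
  set υ := concat u (stop u p, brownianCPath ω₂) with hυ
  have hW := continuous_drvK κ p
  have hW' := continuous_drvK κ υ
  have heq : ∀ s, s ≤ u → drvK κ p s = drvK κ υ s := fun s hs ↦ by
    rw [hυ, drvK_concat_of_le _ _ hs, drvK_stop_of_le κ p hs]
  have hcl : closedHull (drvK κ υ) u = closedHull (drvK κ p) u := (closedHull_eq_of_eqOn hW hW' heq).symm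
  have halive' : Disjoint (closedHull (drvK κ υ) u) A := by rw [hcl]; exact halive
  have hsl : slidHull (drvK κ υ) A u = slidHull (drvK κ p) A u :=
    slidHull_eq_of_eqOn hW hW' heq fun a ha ↦ lt_swallowingTime_of_alive hA halive ha
  have hB := Loewner.isStarHull_slidHull_of_disjoint hW hA halive
  obtain ⟨hc0, hc1, h4, hh1⟩ := imageStep_hull_smallness hB hρ₀ hρ1 hδ0 hδ hh
  have hδ1 : δ₀ ≤ 1 := hδ.trans (starDeriv_pos_le_one _).2
  have hshift : (fun r ↦ drvK κ υ (u + r) - drvK κ υ u) = stepDriverK κ ω₂ := shift_drvK_concat_brownianCPath (stop u p) ω₂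
  have hω₂' : Real.sqrt κ * runSup h ω₂ ≤ δ₀ * ρ₀ / 4000 := hω₂
  have hS : ∀ r : ℝ≥0, r ≤ h → |drvK κ υ (u + r) - drvK κ υ u| ≤ δ₀ * ρ₀ / 4000 := fun r hr ↦ by
    rw [congrFun hshift r]; exact (abs_stepDriverK_le_sqrt_mul_runSup κ hr ω₂).trans hω₂'
  have hcρ : δ₀ * ρ₀ / 4000 ≤ ρ₀ / 4000 := by
    rw [div_le_div_iff_of_pos_right (by norm_num)]; nlinarith
  have hη : stepSize (δ₀ * ρ₀ / 4000) h ≤ ρ₀ := by rw [stepSize]; linarith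
  have hh4 : (h : ℝ) ≤ (ρ₀ / 4) ^ 2 := by nlinarith
  have hBρ' : Disjoint (ball (0 : ℂ) (8 * ρ₀)) (slidHull (drvK κ υ) A u) := by rw [hsl]; exact hBρ
  have hal : Disjoint (closedHull (drvK κ υ) (u + h)) A := disjoint_closedHull_add hW' hA halive' hρ₀ hBρ' hh0 hS hη hh4
  refine ⟨hal, ?_⟩
  rw [imageDrvFnK_add_sub hA halive' hal, hshift, hsl]

end Frozen

/-! ### The one-step constants: monotone in `|d|`, `|c₂|`, affine / quadratic in the envelope level -/

section Constants

/-- `imageStepC κ c d c₂ K M₀ M₁ ≤ α₁(κ, c, j, K, M₁) + p M₀` for `|d| ≤ 1`, `|c₂| ≤ j`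
(`p = 128κ²/c⁴`). [folklore] -/
theorem imageStepC_le_of_abs_le {κ c d c₂ K M₀ M₁ j : ℝ} (hκ : 0 ≤ κ) (hd : |d| ≤ 1) (hc₂ : |c₂| ≤ j) :
    imageStepC κ c d c₂ K M₀ M₁ ≤
      (K * (3 * Real.sqrt κ + 5 + 2 * κ * Real.sqrt κ) + 3 * j * (128 * κ ^ 2 / c ^ 4) +
        2 * M₁ * Real.sqrt (128 * κ ^ 2 / c ^ 4) + Real.sqrt κ * Real.sqrt (128 * κ ^ 2 / c ^ 4) +
        j * κ * Real.sqrt (128 * κ ^ 2 / c ^ 4)) + 128 * κ ^ 2 / c ^ 4 * M₀ := by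
  rw [imageStepC]
  have hp : 0 ≤ 128 * κ ^ 2 / c ^ 4 := by positivity
  have hsp : 0 ≤ Real.sqrt (128 * κ ^ 2 / c ^ 4) := Real.sqrt_nonneg _
  have hs : 0 ≤ Real.sqrt κ := Real.sqrt_nonneg _
  have e1 := mul_le_mul_of_nonneg_right hc₂ hp
  have e2 := mul_le_mul_of_nonneg_right hd (mul_nonneg hs hsp)
  have e3 := mul_le_mul_of_nonneg_right hc₂ (mul_nonneg hκ hsp)
  nlinarith [e1, e2, e3]

/-- `imageStepC₂ κ c d c₂ K M₀ M₁ ≤ α₂(κ, c, j, K, M₁) + 2 p M₀²` for `|d| ≤ 1`, `|c₂| ≤ j`, `K ≥ 0`.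
[folklore] -/
theorem imageStepC₂_le_of_abs_le {κ c d c₂ K M₀ M₁ j : ℝ} (hκ : 0 ≤ κ) (hK : 0 ≤ K) (hd : |d| ≤ 1) (hc₂ : |c₂| ≤ j) :
    imageStepC₂ κ c d c₂ K M₀ M₁ ≤
      (2 * (7 * K + 3 * j) ^ 2 + 6 * (K + j / 2) ^ 2 * κ ^ 2 + 2 * (7 * K + 3 * j) * Real.sqrt κ +
        4 * (K + j / 2) * κ * Real.sqrt κ + 10 * M₁ ^ 2 * Real.sqrt (128 * κ ^ 2 / c ^ 4) +
        2 * κ * Real.sqrt (128 * κ ^ 2 / c ^ 4)) + 2 * (128 * κ ^ 2 / c ^ 4) * M₀ ^ 2 := by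
  rw [imageStepC₂]
  have hp : 0 ≤ 128 * κ ^ 2 / c ^ 4 := by positivity
  have hsp : 0 ≤ Real.sqrt (128 * κ ^ 2 / c ^ 4) := Real.sqrt_nonneg _
  have hs : 0 ≤ Real.sqrt κ := Real.sqrt_nonneg _
  have hd0 : 0 ≤ |d| := abs_nonneg _
  have hc0 : 0 ≤ |c₂| := abs_nonneg _
  have hA0 : 0 ≤ 7 * K + 3 * |c₂| := by positivity
  have hB0 : 0 ≤ K + |c₂| / 2 := by positivity
  have f1 : (7 * K + 3 * |c₂|) ^ 2 ≤ (7 * K + 3 * j) ^ 2 := pow_le_pow_left₀ hA0 (by linarith) 2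
  have f2 : (K + |c₂| / 2) ^ 2 ≤ (K + j / 2) ^ 2 := pow_le_pow_left₀ hB0 (by linarith) 2
  have f3 : |d| * (7 * K + 3 * |c₂|) ≤ 7 * K + 3 * j :=
    (mul_le_mul hd (by linarith : 7 * K + 3 * |c₂| ≤ 7 * K + 3 * j) hA0 zero_le_one).trans_eq (one_mul _)
  have f4 : |d| * (K + |c₂| / 2) ≤ K + j / 2 :=
    (mul_le_mul hd (by linarith : K + |c₂| / 2 ≤ K + j / 2) hB0 zero_le_one).trans_eq (one_mul _)
  have f5 : d ^ 2 ≤ 1 := by rw [← sq_abs]; nlinarith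
  have g1 := mul_le_mul_of_nonneg_right f2 (sq_nonneg κ)
  have g3 := mul_le_mul_of_nonneg_right f3 hs
  have g4 := mul_le_mul_of_nonneg_right f4 (mul_nonneg hκ hs)
  have g5 := mul_le_mul_of_nonneg_right f5 (mul_nonneg hκ hsp)
  nlinarith [f1, g1, g3, g4, g5]

end Constants

end Literature.Probability.RandomPlanarGeometry

end
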